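import Literature.NumberTheory.NumberFields.AlgClosureCubeRootsOfUnity
import Literature.NumberTheory.NumberFields.UnramifiedCubicBaseChange
import Mathlib.FieldTheory.KummerExtension
import Mathlib.FieldTheory.Galois.GaloisClosure
import Mathlib.NumberTheory.RamificationInertia.Unramified
import HarnessLib

/-!
# The Kummer generator attached to an unramified cubic extension of a quadratic field (Scholz)

Topic `NumberTheory/NumberFields`.  Theorem-only file (no definition, no named fact).

The Kummer-theoretic heart of Scholz's reflection theorem in the form of Washington, *Introduction
to Cyclotomic Fields*, proof of Thm. 10.10.  `K` is a quadratic field with `ζ = ζ₃ ∉ K`,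
`M = K(ζ)`, `g ∈ Aut(K̄/ℚ)` with `g|_K ≠ 1`, `g(ζ) = ζ²`, `k ⊇ M^{g}` the mirror field inside `M`;
`E/K` is cyclic cubic, unramified at all finite primes, `g`-stable with `g` inverting `Gal(E/K)`
(the cubic class fields of `K`, `QuadraticFields/CubicClassFieldNormal.lean`).
`exists_kummer_generator`: by Kummer theory (Mathlib `exists_root_adjoin_eq_top_of_isCyclic`)
`L = E(ζ) = M(α)`, `α³ = θ ∈ M`, and a generator `σ` of `Gal(L/M)` (lifted to `h ∈ Aut(K̄/K)`) has
`h(α) = ωα`; the dihedral relation gives `h(gα) = ω·gα`, so `λ := α·g(α)` has `h(λ) = ω²λ`: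
`λ ∉ M`, `L = M(λ)` (so **`E` is recovered from `λ`**), and `θ' := λ³ = θ·g(θ)` is in `M`, fixed by
`g` (`g² = 1` on `M`), i.e. **`θ' ∈ k`, not a cube in `M`**; as `E/K` is unramified so is `L/M`
(`ramificationIdx_eq_one_of_isUnramifiedIn`), whence **`3 ∣ v_𝔭(θ')` for all primes `𝔭` of `k`**
(`three_dvd_log_valuation_of_eq_cube`).  These feed `two_mul_card_add_one_le_of_dvd_valuation`.

## References

* L. C. Washington, *Introduction to Cyclotomic Fields*, GTM 83, 2nd ed. (1997), Thm. 10.10 and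
  its proof. [Washington1997]
* A. Scholz, *Über die Beziehung der Klassenzahlen quadratischer Körper zueinander*, J. reine
  angew. Math. 166 (1932), 201–203. [Scholz1932]
-/

noncomputable section

open NumberField Module IsDedekindDomain WithZero
open scoped IntermediateField

namespace Literature.NumberTheory.NumberFields

/-! ### Two general lemmas -/

/-- An automorphism of `E/F` fixing a generator `a` of `E = F(a)` is the identity. [folklore] -/
theorem algEquiv_eq_one_of_apply_eq {F E : Type*} [Field F] [Field E] [Algebra F E] {a : E}
    (htop : F⟮a⟯ = ⊤) (σ : E ≃ₐ[F] E) (hσ : σ a = a) : σ = 1 := by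
  let S : IntermediateField F E :=
    (AlgHom.equalizer (σ : E →ₐ[F] E) (AlgHom.id F E)).toIntermediateField fun y hy => by
      rw [AlgHom.mem_equalizer] at hy ⊢
      change σ y⁻¹ = y⁻¹
      change σ y = y at hy
      rw [map_inv₀, hy]
  have hmem : ∀ y, y ∈ S ↔ σ y = y := fun y => by
    change y ∈ AlgHom.equalizer _ _ ↔ _
    rw [AlgHom.mem_equalizer]
    rfl
  have hle : F⟮a⟯ ≤ S := IntermediateField.adjoin_simple_le_iff.mpr ((hmem a).mpr hσ)
  rw [htop] at hle
  ext y
  exact (hmem y).mp (hle IntermediateField.mem_top)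

/-- **Unramifiedness is invariant under `K`-isomorphisms of the top field.** [folklore] -/
theorem isUnramifiedIn_of_algEquiv_of_isUnramifiedIn {K : Type*} [Field K] [NumberField K]
    {E E' : Type*} [Field E] [NumberField E] [Algebra K E] [Field E'] [NumberField E']
    [Algebra K E'] (f : E ≃ₐ[K] E') {p : Ideal (𝓞 K)} (hp : p ≠ ⊥)
    (h : Algebra.IsUnramifiedIn (𝓞 E') p) : Algebra.IsUnramifiedIn (𝓞 E) p := by
  let F : 𝓞 E ≃ₐ[𝓞 K] 𝓞 E' := RingOfIntegers.mapAlgEquiv f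
  rw [Algebra.isUnramifiedIn_iff_forall_ramificationIdx_eq_one] at h ⊢
  intro P _ hP
  haveI := hP
  haveI : (P.map F).IsPrime := Ideal.map_isPrime_of_equiv F
  have h1 : (P.map F).ramificationIdx (𝓞 K) = 1 := h (P.map F) inferInstance
  have hcomap : (P.map F).comap F = P := Ideal.comap_map_of_bijective F F.bijective
  rw [← Ideal.ramificationIdx'_eq_ramificationIdx (p := p) (q := P) hp,
    ← Ideal.ramificationIdx'_eq_ramificationIdx (p := p) (q := P.map F) hp] at *
  rw [← h1, ← Ideal.ramificationIdx'_comap_eq (p := p) F (P.map F), hcomap]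

/-- A vector space in which every vector is a combination of two fixed vectors has dimension at
most `2`. [folklore] -/
theorem finrank_le_two_of_forall_exists {F V : Type*} [Field F] [AddCommGroup V] [Module F V]
    (a b : V) (h : ∀ x : V, ∃ u w : F, x = u • a + w • b) : finrank F V ≤ 2 := by
  have h1 := finrank_le_of_span_eq_top (R := F) (M := V) (v := ![a, b]) (by
    rw [eq_top_iff]
    rintro x -
    obtain ⟨u, w, rfl⟩ := h x
    exact add_mem (Submodule.smul_mem _ _ (Submodule.subset_span ⟨0, rfl⟩))
      (Submodule.smul_mem _ _ (Submodule.subset_span ⟨1, rfl⟩)))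
  simpa using h1

/-! ### The Kummer generator -/

set_option maxHeartbeats 400000 in
/-- **Scholz's Kummer generator.**  `K` quadratic, `ζ = ζ₃ ∉ K`, `g ∈ Aut(K̄/ℚ)` with `g(ζ) = ζ²`,
`k ⊆ M = K(ζ)` a quadratic field containing `M^{g}`; `E/K` cubic Galois, unramified at all finite
primes, `g`-stable with `g h g⁻¹ = h⁻¹` on `E` for all `h ∈ Aut(K̄/K)`.  Then there are `θ ∈ kˣ` and
`λ ∈ E(ζ)` with `λ³ = θ`, `θ ∉ M³`, `E ⊆ F` for every field `F ⊇ M ∪ {λ}`, and `3 ∣ v_𝔭(θ)` for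
all primes `𝔭` of `k` (Washington, proof of Thm. 10.10: "`L(∛β)/L` comes from an unramified cubic
extension of `ℚ(√-3d)` … `(β) = 𝔟³`", here run from the cubic field to `β = θ`).
[cite: Washington1997, Thm 10.10 (proof)] -/
theorem exists_kummer_generator {K : Type} [Field K] [NumberField K] [IsGalois ℚ K]
    (h2 : finrank ℚ K = 2)
    {ζ : AlgebraicClosure K} (hζ : IsPrimitiveRoot ζ 3)
    (hζK : ζ ∉ Set.range (algebraMap K (AlgebraicClosure K)))
    {g : AlgebraicClosure K ≃ₐ[ℚ] AlgebraicClosure K} (hgζ : g ζ = ζ ^ 2)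
    (k : IntermediateField ℚ (AlgebraicClosure K)) [NumberField k]
    (hkM : ∀ x : AlgebraicClosure K, x ∈ k → x ∈ K⟮ζ⟯)
    (hMk : ∀ x ∈ K⟮ζ⟯, g x = x → x ∈ k)
    (E : IntermediateField K (AlgebraicClosure K)) [FiniteDimensional K E] [IsGalois K E]
    (h3 : finrank K E = 3)
    (hunr : ∀ v : HeightOneSpectrum (𝓞 K), Algebra.IsUnramifiedIn (𝓞 E) v.asIdeal)
    (hgE : ∀ x ∈ E, g x ∈ E)
    (hinv : ∀ (h : AlgebraicClosure K ≃ₐ[K] AlgebraicClosure K), ∀ y ∈ E, g (h y) = h.symm (g y)) :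
    ∃ (θ : k) (lam : AlgebraicClosure K), θ ≠ 0 ∧ lam ∈ E ⊔ K⟮ζ⟯ ∧
      lam ^ 3 = (θ : AlgebraicClosure K) ∧
      (∀ m ∈ K⟮ζ⟯, m ^ 3 ≠ (θ : AlgebraicClosure K)) ∧
      (∀ F : IntermediateField K (AlgebraicClosure K), K⟮ζ⟯ ≤ F → lam ∈ F → E ≤ F) ∧
      ∀ v : HeightOneSpectrum (𝓞 k), (3 : ℤ) ∣ log (v.valuation k θ) := by
  classical
  haveI hMfd : FiniteDimensional K K⟮ζ⟯ := finiteDimensional_adjoin ζ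
  haveI hMgal : IsGalois K K⟮ζ⟯ := isGalois_adjoin hζ
  have hM2 : finrank K K⟮ζ⟯ = 2 := finrank_adjoin_eq_two hζ hζK
  have hζM : ζ ∈ K⟮ζ⟯ := IntermediateField.mem_adjoin_simple_self K ζ
  -- the compositum `L = E(ζ)`
  let L : IntermediateField K (AlgebraicClosure K) := E ⊔ K⟮ζ⟯
  haveI hLfd : FiniteDimensional K L := IntermediateField.finiteDimensional_sup E K⟮ζ⟯
  haveI hLgal : IsGalois K L := by
    change IsGalois K (E ⊔ K⟮ζ⟯ : IntermediateField K (AlgebraicClosure K))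
    infer_instance
  haveI hLnf : NumberField L := NumberField.of_module_finite K L
  have hL6 : finrank K L = 6 := finrank_sup_adjoin_eq hζ hζK E h3
  have hEL_le : E ≤ L := le_sup_left
  have hML_le : K⟮ζ⟯ ≤ L := le_sup_right
  -- `E` and `M = K(ζ)` inside `L`
  let E₀ : IntermediateField K L := IntermediateField.restrict hEL_le
  let M₀ : IntermediateField K L := IntermediateField.restrict hML_le
  have hmemM₀ : ∀ x : L, x ∈ M₀ ↔ (x : AlgebraicClosure K) ∈ K⟮ζ⟯ :=
    IntermediateField.mem_restrict hML_le
  let eE : E ≃ₐ[K] E₀ := IntermediateField.restrict_algEquiv hEL_le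
  let eM : K⟮ζ⟯ ≃ₐ[K] M₀ := IntermediateField.restrict_algEquiv hML_le
  haveI : FiniteDimensional K E₀ := LinearEquiv.finiteDimensional eE.toLinearEquiv
  haveI : FiniteDimensional K M₀ := LinearEquiv.finiteDimensional eM.toLinearEquiv
  have hE₀3 : finrank K E₀ = 3 := by rw [← eE.toLinearEquiv.finrank_eq, h3]
  have hM₀2 : finrank K M₀ = 2 := by rw [← eM.toLinearEquiv.finrank_eq, hM2]
  have hEL : finrank E₀ L = 2 := by
    have h := Module.finrank_mul_finrank K E₀ L
    rw [hE₀3, hL6] at h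
    omega
  have hML : finrank M₀ L = 3 := by
    have h := Module.finrank_mul_finrank K M₀ L
    rw [hM₀2, hL6] at h
    omega
  haveI : IsGalois M₀ L := IsGalois.tower_top_of_isGalois K M₀ L
  haveI : NumberField E := NumberField.of_module_finite K E
  haveI : NumberField E₀ := NumberField.of_module_finite K E₀
  haveI : NumberField M₀ := NumberField.of_module_finite K M₀
  -- `E₀/K` unramified, hence `L/M₀` unramified
  have hunr₀ : ∀ v : HeightOneSpectrum (𝓞 K), Algebra.IsUnramifiedIn (𝓞 E₀) v.asIdeal :=
    fun v => isUnramifiedIn_of_algEquiv_of_isUnramifiedIn eE.symm v.ne_bot (hunr v)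
  have hunrL : ∀ (P : Ideal (𝓞 L)) [P.IsMaximal], P ≠ ⊥ → P.ramificationIdx (𝓞 M₀) = 1 :=
    fun P _ hP => ramificationIdx_eq_one_of_isUnramifiedIn E₀ M₀ hEL hML hunr₀ P hP
  -- Kummer theory: `L = M₀(α)`, `α³ = t`
  have hprim : (primitiveRoots (finrank M₀ L) M₀).Nonempty := by
    rw [hML]
    refine ⟨⟨⟨ζ, hML_le hζM⟩, (hmemM₀ _).mpr hζM⟩, ?_⟩
    rw [mem_primitiveRoots (by norm_num : 0 < 3)]
    exact IsPrimitiveRoot.of_map_of_injective (f := algebraMap M₀ (AlgebraicClosure K)) hζ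
      (algebraMap M₀ (AlgebraicClosure K)).injective
  haveI : Fact (Nat.Prime 3) := ⟨Nat.prime_three⟩
  haveI : IsCyclic (L ≃ₐ[M₀] L) :=
    isCyclic_of_prime_card (p := 3) (by rw [IsGalois.card_aut_eq_finrank, hML])
  obtain ⟨α, hα3, hαtop⟩ := exists_root_adjoin_eq_top_of_isCyclic M₀ L hprim
  rw [hML] at hα3
  obtain ⟨t, ht⟩ := hα3
  -- `α ∉ M₀`, `α ≠ 0`
  have hαbot : α ∉ (⊥ : IntermediateField M₀ L) := by
    intro hαb
    have h1 : finrank M₀ M₀⟮α⟯ = 1 := IntermediateField.finrank_adjoin_simple_eq_one_iff.mpr hαb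
    rw [hαtop, IntermediateField.finrank_top', hML] at h1
    exact absurd h1 (by norm_num)
  have hα0 : α ≠ 0 := fun h0 => hαbot (by rw [h0]; exact zero_mem _)
  -- a non-trivial `σ₀ ∈ Gal(L/M₀)` (it moves the generator `α`)
  obtain ⟨σ₀, hσ₀⟩ : ∃ σ₀ : L ≃ₐ[M₀] L, σ₀ α ≠ α := by
    by_contra hall
    push Not at hall
    have h1 : ∀ σ : L ≃ₐ[M₀] L, σ = 1 := fun σ => algEquiv_eq_one_of_apply_eq hαtop σ (hall σ)
    have hc := Nat.card_eq_one_iff_unique.mpr ⟨⟨fun a b => by rw [h1 a, h1 b]⟩, ⟨(1 : L ≃ₐ[M₀] L)⟩⟩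
    rw [IsGalois.card_aut_eq_finrank, hML] at hc
    exact absurd hc (by norm_num)
  -- Ω-level elements: `a = α`, `θ₁ = t`, `b = σ₀ α`
  set a : AlgebraicClosure K := (α : AlgebraicClosure K) with hadef
  set θ₁ : AlgebraicClosure K := ((t : L) : AlgebraicClosure K) with hθ₁def
  set b : AlgebraicClosure K := ((σ₀ α : L) : AlgebraicClosure K) with hbdef
  have hθ₁M : θ₁ ∈ K⟮ζ⟯ := (hmemM₀ (t : L)).mp t.2
  have haL : a ∈ L := α.2
  have ha3 : a ^ 3 = θ₁ := by
    have h := congrArg Subtype.val ht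
    rw [SubmonoidClass.coe_pow] at h
    exact h.symm
  have hb3 : b ^ 3 = θ₁ := by
    have h : (σ₀ α) ^ 3 = algebraMap M₀ L t := by rw [← map_pow, ← ht, AlgEquiv.commutes]
    have h' := congrArg Subtype.val h
    rw [SubmonoidClass.coe_pow] at h'
    exact h'
  have ha0 : a ≠ 0 := fun h0 => hα0 (Subtype.ext h0)
  -- lift `σ₀` to `h ∈ Aut(K̄/K)`; it fixes `M` pointwise
  let h : AlgebraicClosure K ≃ₐ[K] AlgebraicClosure K :=
    (σ₀.restrictScalars K).liftNormal (AlgebraicClosure K)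
  have hh : ∀ x : L, h (x : AlgebraicClosure K) = ((σ₀ x : L) : AlgebraicClosure K) := fun x =>
    AlgEquiv.liftNormal_commutes (σ₀.restrictScalars K) (AlgebraicClosure K) x
  have hhM : ∀ x ∈ K⟮ζ⟯, h x = x := by
    intro x hx
    have hxL : x ∈ L := hML_le hx
    have h1 := hh ⟨x, hxL⟩
    have h2' : σ₀ ⟨x, hxL⟩ = ⟨x, hxL⟩ :=
      AlgEquiv.commutes σ₀ (⟨⟨x, hxL⟩, (hmemM₀ _).mpr hx⟩ : M₀)
    rw [h2'] at h1
    exact h1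
  have hha : h a = b := hh α
  -- `ω = σ₀(α)/α`, a primitive cube root of unity
  obtain ⟨ω, hω3, hbω⟩ := exists_eq_mul_of_pow_three_eq ha0 (hb3.trans ha3.symm)
  have hω1 : ω ≠ 1 := by
    intro h1
    rw [h1, one_mul] at hbω
    exact hσ₀ (Subtype.ext hbω)
  have hω3' : ω ^ 2 * ω = 1 := by rw [← pow_succ]; exact hω3
  have hω2ne : ω ^ 2 ≠ 1 := by
    intro h22
    apply hω1
    rw [← hω3', h22, one_mul]
  have hωM : ω ∈ K⟮ζ⟯ := mem_adjoin_of_pow_three_eq_one hζ hω3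
  have hgω : g ω = ω ^ 2 := apply_eq_sq_of_pow_three_eq_one hζ g hgζ hω3
  -- the `K`-automorphism `A = g⁻¹ h g`
  have hAK : ∀ y : K, (g.toRingEquiv.trans (h.toRingEquiv.trans g.symm.toRingEquiv))
      (algebraMap K (AlgebraicClosure K) y) = algebraMap K (AlgebraicClosure K) y := by
    intro y
    change g.symm (h (g (algebraMap K (AlgebraicClosure K) y))) = algebraMap K _ y
    rw [← AlgEquiv.restrictNormal_commutes g, AlgEquiv.commutes, AlgEquiv.restrictNormal_commutes,
      AlgEquiv.symm_apply_apply]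
  let A : AlgebraicClosure K ≃ₐ[K] AlgebraicClosure K := AlgEquiv.ofRingEquiv hAK
  have hA : ∀ y, A y = g.symm (h (g y)) := fun y => rfl
  -- `A = h⁻¹` on `E` (dihedral relation) and on `ζ`, hence on `L`
  have hAE : ∀ y ∈ E, A y = h.symm y := by
    intro y hy
    rw [hA]
    have h1 := hinv h.symm y hy
    rw [AlgEquiv.symm_symm] at h1
    rw [← h1, AlgEquiv.symm_apply_apply]
  have hsymmζ : h.symm ζ = ζ := by
    rw [AlgEquiv.symm_apply_eq]
    exact (hhM ζ hζM).symm
  have hAζ : A ζ = h.symm ζ := by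
    rw [hA, hgζ, hhM _ (pow_mem hζM 2), hsymmζ, AlgEquiv.symm_apply_eq, hgζ]
  have hAL : ∀ y ∈ L, A y = h.symm y := by
    intro y hy
    obtain ⟨S, hS⟩ := exists_intermediateField_eqOn A h.symm
    refine eqOn_sup A h.symm hAE (fun z hz => ?_) hy
    exact (hS z).mp (IntermediateField.adjoin_simple_le_iff.mpr ((hS ζ).mpr hAζ) hz)
  -- `c = g(a)` and `h(c) = ω c`
  set c : AlgebraicClosure K := g a with hcdef
  have hsymm_a : h.symm a = ω ^ 2 * a := by
    rw [AlgEquiv.symm_apply_eq, map_mul, map_pow, hhM ω hωM, hha, hbω, ← mul_assoc, hω3', one_mul]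
  have hhc : h c = ω * c := by
    have h1 := hAL a haL
    rw [hA, hsymm_a, AlgEquiv.symm_apply_eq] at h1
    rw [hcdef, h1, map_mul, map_pow, hgω, ← pow_mul, show 2 * 2 = 3 + 1 by rfl, pow_succ, hω3,
      one_mul]
  -- `λ = a c`, `θ' = λ³ = θ₁ g(θ₁) ∈ k`
  set lam : AlgebraicClosure K := a * c with hlamdef
  set θ' : AlgebraicClosure K := θ₁ * g θ₁ with hθ'def
  have hc3 : c ^ 3 = g θ₁ := by rw [hcdef, ← map_pow, ha3]
  have hlam3 : lam ^ 3 = θ' := by rw [hlamdef, mul_pow, ha3, hc3]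
  have hθ'M : θ' ∈ K⟮ζ⟯ := mul_mem hθ₁M (apply_mem_adjoin_of hζ g hθ₁M)
  have hgθ' : g θ' = θ' := by
    rw [hθ'def, map_mul, apply_apply_eq_self_of_mem_adjoin hζ h2 g hgζ hθ₁M, mul_comm]
  have hθ'k : θ' ∈ k := hMk θ' hθ'M hgθ'
  have hhlam : h lam = ω ^ 2 * lam := by
    rw [hlamdef, map_mul, hha, hhc, hbω]
    ring
  have hc0 : c ≠ 0 := by rw [hcdef]; exact (map_ne_zero g).mpr ha0
  have hlam0 : lam ≠ 0 := mul_ne_zero ha0 hc0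
  have hθ'0 : θ' ≠ 0 := by rw [← hlam3]; exact pow_ne_zero 3 hlam0
  have hlamM : lam ∉ K⟮ζ⟯ := by
    intro hm
    have h1 := hhM lam hm
    rw [hhlam] at h1
    exact hω2ne ((mul_eq_right₀ hlam0).mp h1)
  have hcL : c ∈ L :=
    apply_mem_sup_of g (fun x hx => hEL_le (hgE x hx))
      (fun x hx => hML_le (apply_mem_adjoin_of hζ g hx)) haL
  have hlamL : lam ∈ L := mul_mem haL hcL
  -- `E ⊆ F` whenever `M ∪ {λ} ⊆ F`: `L = M₀(λ)`
  have hgen : ∀ F : IntermediateField K (AlgebraicClosure K), K⟮ζ⟯ ≤ F → lam ∈ F → E ≤ F := by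
    intro F hMF hlamF
    let lamL : L := ⟨lam, hlamL⟩
    have hlamLbot : lamL ∉ (⊥ : IntermediateField M₀ L) := by
      intro hb
      rw [IntermediateField.mem_bot] at hb
      obtain ⟨m, hm⟩ := hb
      apply hlamM
      have h1 := congrArg Subtype.val hm
      change ((m : L) : AlgebraicClosure K) = lam at h1
      rw [← h1]
      exact (hmemM₀ (m : L)).mp m.2
    have htoplam : M₀⟮lamL⟯ = ⊤ := by
      have hdvd : finrank M₀ M₀⟮lamL⟯ ∣ 3 := by
        have h1 := IntermediateField.finrank_dvd_of_le_right (le_top : M₀⟮lamL⟯ ≤ ⊤)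
        rwa [IntermediateField.finrank_top', hML] at h1
      have hne1 : finrank M₀ M₀⟮lamL⟯ ≠ 1 := fun h1 =>
        hlamLbot (IntermediateField.finrank_adjoin_simple_eq_one_iff.mp h1)
      have h3' : finrank M₀ M₀⟮lamL⟯ = 3 := by
        rcases (Nat.dvd_prime Nat.prime_three).mp hdvd with h1 | h1
        · exact absurd h1 hne1
        · exact h1
      apply IntermediateField.eq_of_le_of_finrank_eq le_top
      rw [h3', IntermediateField.finrank_top', hML]
    let S : Subfield L := F.toSubfield.comap (algebraMap L (AlgebraicClosure K))
    have hSmem : ∀ x : L, x ∈ S ↔ (x : AlgebraicClosure K) ∈ F := fun x => by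
      rw [Subfield.mem_comap]
      rfl
    let F₀ : IntermediateField M₀ L :=
      S.toIntermediateField fun m => (hSmem _).mpr (hMF ((hmemM₀ (m : L)).mp m.2))
    have hF₀mem : ∀ x : L, x ∈ F₀ ↔ (x : AlgebraicClosure K) ∈ F := fun x => hSmem x
    have hF₀top : (⊤ : IntermediateField M₀ L) ≤ F₀ := by
      rw [← htoplam]
      exact IntermediateField.adjoin_simple_le_iff.mpr ((hF₀mem _).mpr hlamF)
    intro x hx
    exact (hF₀mem ⟨x, hEL_le hx⟩).mp (hF₀top IntermediateField.mem_top)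
  -- the element of `k` and the tower `k ⊆ M₀ ⊆ L`
  let θk : k := ⟨θ', hθ'k⟩
  have hθk0 : θk ≠ 0 := fun h0 => hθ'0 (congrArg Subtype.val h0)
  have hkL : ∀ x : AlgebraicClosure K, x ∈ k → x ∈ L := fun x hx => hML_le (hkM x hx)
  let fkM : k →+* M₀ :=
    { toFun := fun x => ⟨⟨x.1, hkL x.1 x.2⟩, (hmemM₀ _).mpr (hkM x.1 x.2)⟩
      map_one' := rfl
      map_mul' := fun _ _ => rfl
      map_zero' := rfl
      map_add' := fun _ _ => rfl }
  letI : Algebra k M₀ := fkM.toAlgebra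
  letI : Algebra k L := ((algebraMap M₀ L).comp fkM).toAlgebra
  haveI : IsScalarTower k M₀ L := IsScalarTower.of_algebraMap_eq fun _ => rfl
  -- `[M₀ : k] ≤ 2`: every `x ∈ M` is `u + w ζ` with `w = (x - g x)/(1 + 2ζ)`, `u = x - w ζ` in `M^g ⊆ k`
  have hζ2 : ζ ^ 2 = -ζ - 1 := by
    have h1 := minpoly.aeval K ζ
    rw [minpoly_eq hζ hζK] at h1
    simp only [map_add, map_pow, Polynomial.aeval_X, map_one] at h1
    linear_combination h1
  have h12ζ : (1 + 2 * ζ : AlgebraicClosure K) ≠ 0 := by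
    intro h0
    have h1 : (1 + 2 * ζ : AlgebraicClosure K) ^ 2 = -3 := by
      rw [add_sq, mul_pow, ← mul_assoc, hζ2]; ring
    rw [h0] at h1
    norm_num at h1
  have h2M : (2 : AlgebraicClosure K) ∈ K⟮ζ⟯ := by exact_mod_cast K⟮ζ⟯.natCast_mem 2
  let ζM : M₀ := ⟨⟨ζ, hML_le hζM⟩, (hmemM₀ _).mpr hζM⟩
  have hspan : ∀ x : M₀, ∃ u w : k, x = u • (1 : M₀) + w • ζM := by
    intro x
    have hxM : ((x : L) : AlgebraicClosure K) ∈ K⟮ζ⟯ := (hmemM₀ _).mp x.2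
    set xΩ : AlgebraicClosure K := ((x : L) : AlgebraicClosure K) with hxΩ
    set wΩ : AlgebraicClosure K := (xΩ - g xΩ) / (1 + 2 * ζ) with hwΩ
    set uΩ : AlgebraicClosure K := xΩ - wΩ * ζ with huΩ
    have hgx : g (g xΩ) = xΩ := apply_apply_eq_self_of_mem_adjoin hζ h2 g hgζ hxM
    have hgxM : g xΩ ∈ K⟮ζ⟯ := apply_mem_adjoin_of hζ g hxM
    have hwM : wΩ ∈ K⟮ζ⟯ :=
      div_mem (sub_mem hxM hgxM) (add_mem (one_mem _) (mul_mem h2M hζM))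
    have hgw : g wΩ = wΩ := by
      have hden : (1 + 2 * ζ ^ 2 : AlgebraicClosure K) = -(1 + 2 * ζ) := by rw [hζ2]; ring
      rw [hwΩ, map_div₀, map_sub, map_add, map_one, map_mul, map_ofNat, hgx, hgζ, hden,
        show g xΩ - xΩ = -(xΩ - g xΩ) by ring, neg_div_neg_eq]
    have huM : uΩ ∈ K⟮ζ⟯ := sub_mem hxM (mul_mem hwM hζM)
    have hgu : g uΩ = uΩ := by
      have hw' : wΩ * (1 + 2 * ζ) = xΩ - g xΩ := div_mul_cancel₀ _ h12ζ
      rw [huΩ, map_sub, map_mul, hgw, hgζ, hζ2]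
      linear_combination hw'
    refine ⟨⟨uΩ, hMk _ huM hgu⟩, ⟨wΩ, hMk _ hwM hgw⟩, ?_⟩
    apply Subtype.ext
    apply Subtype.ext
    change xΩ = uΩ * 1 + wΩ * ζ
    rw [huΩ]
    ring
  have hkM₀ : finrank k M₀ ≤ 2 := finrank_le_two_of_forall_exists (1 : M₀) ζM hspan
  have hval : ∀ v : HeightOneSpectrum (𝓞 k), (3 : ℤ) ∣ log (v.valuation k θk) := by
    intro v
    refine three_dvd_log_valuation_of_eq_cube (k := k) (M := M₀) (L := L) hkM₀ hunrL
      (x := θk) (y := ⟨lam, hlamL⟩) ?_ v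
    apply Subtype.ext
    rw [SubmonoidClass.coe_pow]
    exact hlam3.symm
  refine ⟨θk, lam, hθk0, hlamL, hlam3, ?_, hgen, hval⟩
  -- `θ'` is not a cube in `M`
  intro m hm hm3
  obtain ⟨ω', hω'3, hmeq⟩ := exists_eq_mul_of_pow_three_eq hlam0 (hm3.trans hlam3.symm)
  apply hlamM
  have h1 : lam = ω' ^ 2 * m := by
    rw [hmeq, ← mul_assoc, ← pow_succ, hω'3, one_mul]
  rw [h1]
  exact mul_mem (pow_mem (mem_adjoin_of_pow_three_eq_one hζ hω'3) 2) hm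

end Literature.NumberTheory.NumberFields

end
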